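import Mathlib.Probability.Distributions.Gaussian.Fernique
import Mathlib.MeasureTheory.Measure.Haar.NormedSpace
import Literature.Analysis.FluidPDE.BoltzmannEquation
import Literature.MathematicalPhysics.KineticTheory.HardSphereEuler
import Summits.AtomisticToContinuum.HydrodynamicLimit.Theorems.AntiMazurCoboundariesCorrectorPressureDecayMaxwellianSecondOrderScalar

/-!
# Second-order vanishing of Maxwellian means of observables orthogonal to the collision invariants

Route `AntiMazurCoboundaries` of `AtomisticToContinuum/HydrodynamicLimit`, crux
stmt-AtomisticToContinuum-14135 (`CorrectorPressureDecay`), line `almost-invariant-duality`, registered stub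
`stub_maxwellianSecondOrder` (skeleton sha 21c4ba7b), signature verbatim: for a continuous `g : ℝ³ → ℝ` with
`|g| ≤ κ` and `g ⊥ span(1, v, |v|²)` in `L²(γ)` (`γ` the standard Gaussian), the mean of `g` under the Maxwellian
with drift `p` and temperature `s`,
`m(p, s) = ∫ g(p + √s u) dγ(u)`,
vanishes to SECOND order at `(p, s) = (0, 1)`:
`|m(p, s)| ≤ κ · C₂ · min 1 (‖p‖² + (s − 1)²)` for a universal `C₂ ≥ 1` (`maxwellianSecondOrder`).

Proof. For `s > 0` the Gaussian change of variables (`integral_comp_affine_stdGaussian`: Lebesgue density of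
`stdGaussian` = `globalMaxwellian`, `Measure.integral_comp_smul`, translation invariance) gives
`m(p,s) = ∫ g · L_{p,s} dγ` with the likelihood ratio `L_{p,s}(v) = s^{-3/2} exp(‖v‖²/2 − ‖v − p‖²/(2s))`;
orthogonality removes the affine-quadratic Taylor part `ℓ = 1 + ⟨p, v⟩ + (s−1)(‖v‖² − 3)/2` of `L` at `(0,1)`
(an element of `span(1, v, |v|²)`), and the pointwise remainder estimate of the scalar file
(`MaxwellianSecondOrder.scalar_key'`: `|L − ℓ| ≤ (‖p‖² + (s−1)²) · K_c · exp(c‖v‖²)` on `‖p‖, |s−1| ≤ c/4`) is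
integrated against `γ` using Fernique's theorem (Mathlib `IsGaussian.exists_integrable_exp_sq`: `∫ exp(C‖v‖²) dγ < ∞`
for some `C > 0`; we work at `c = min C 1`). Outside that neighbourhood the trivial bound `|m| ≤ κ` suffices, with
`C₂ = max(16/c², 1, K_c ∫e^{c‖v‖²}dγ)`.
-/

noncomputable section

open MeasureTheory ProbabilityTheory Real

namespace Summit.AtomisticToContinuum.HydrodynamicLimit.Theorems.MaxwellianSecondOrder

open Literature.MathematicalPhysics.KineticTheory (V3)

/-! ## §2 The Gaussian change of variables and the likelihood ratio -/

open Literature.Analysis.FluidPDE (globalMaxwellian integral_stdGaussian_eq_integral_mul_globalMaxwellian)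

/-- The likelihood-ratio identity `M(v)·L_{p,s}(v) = s^{-3/2} M((v − p)/√s)` on `ℝ³`. [folklore] -/
theorem globalMaxwellian_mul_lr {s : ℝ} (hs : 0 < s) (p v : V3) :
    globalMaxwellian v * (((Real.sqrt s) ^ 3)⁻¹ * exp (‖v‖ ^ 2 / 2 - ‖v - p‖ ^ 2 / (2 * s))) =
      ((Real.sqrt s) ^ 3)⁻¹ * globalMaxwellian ((Real.sqrt s)⁻¹ • (v - p)) := by
  have hsq : ‖(Real.sqrt s)⁻¹ • (v - p)‖ ^ 2 = ‖v - p‖ ^ 2 / s := by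
    rw [norm_smul, norm_inv, Real.norm_eq_abs, abs_of_nonneg (Real.sqrt_nonneg s), mul_pow, inv_pow,
      Real.sq_sqrt hs.le]
    ring
  simp only [globalMaxwellian, hsq]
  have he : exp (-‖v‖ ^ 2 / 2) * exp (‖v‖ ^ 2 / 2 - ‖v - p‖ ^ 2 / (2 * s)) =
      exp (-(‖v - p‖ ^ 2 / s) / 2) := by
    rw [← exp_add]
    congr 1
    ring
  calc (2 * Real.pi) ^ (-(Module.finrank ℝ V3 : ℝ) / 2) * exp (-‖v‖ ^ 2 / 2) *
        (((Real.sqrt s) ^ 3)⁻¹ * exp (‖v‖ ^ 2 / 2 - ‖v - p‖ ^ 2 / (2 * s)))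
      = ((Real.sqrt s) ^ 3)⁻¹ * ((2 * Real.pi) ^ (-(Module.finrank ℝ V3 : ℝ) / 2) *
        (exp (-‖v‖ ^ 2 / 2) * exp (‖v‖ ^ 2 / 2 - ‖v - p‖ ^ 2 / (2 * s)))) := by ring
    _ = ((Real.sqrt s) ^ 3)⁻¹ * ((2 * Real.pi) ^ (-(Module.finrank ℝ V3 : ℝ) / 2) *
        exp (-(‖v - p‖ ^ 2 / s) / 2)) := by rw [he]

/-- **Gaussian change of variables**: the mean of `g` under `N(p, s·I₃)` is the `γ`-integral of `g` against the
likelihood ratio `L_{p,s}(v) = s^{-3/2} exp(‖v‖²/2 − ‖v − p‖²/(2s))` (`s > 0`; no integrability needed, both sides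
being `0` together). [folklore] -/
theorem integral_comp_affine_stdGaussian {s : ℝ} (hs : 0 < s) (p : V3) (g : V3 → ℝ) :
    ∫ u, g (p + Real.sqrt s • u) ∂(stdGaussian V3) =
      ∫ v, g v * (((Real.sqrt s) ^ 3)⁻¹ * exp (‖v‖ ^ 2 / 2 - ‖v - p‖ ^ 2 / (2 * s))) ∂(stdGaussian V3) := by
  have hsqrt : 0 < Real.sqrt s := Real.sqrt_pos.2 hs
  have hσ : 0 < ((Real.sqrt s) ^ 3)⁻¹ := by positivity
  set F : V3 → ℝ := fun v => globalMaxwellian ((Real.sqrt s)⁻¹ • (v - p)) * g v with hF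
  rw [integral_stdGaussian_eq_integral_mul_globalMaxwellian, integral_stdGaussian_eq_integral_mul_globalMaxwellian]
  -- right-hand side: `∫ M·(g·L) = σ ∫ F`
  have hR : (fun v => globalMaxwellian v * (g v * (((Real.sqrt s) ^ 3)⁻¹ *
      exp (‖v‖ ^ 2 / 2 - ‖v - p‖ ^ 2 / (2 * s))))) = fun v => ((Real.sqrt s) ^ 3)⁻¹ * F v := by
    funext v
    rw [hF]
    have := globalMaxwellian_mul_lr hs p v
    calc globalMaxwellian v * (g v * (((Real.sqrt s) ^ 3)⁻¹ * exp (‖v‖ ^ 2 / 2 - ‖v - p‖ ^ 2 / (2 * s))))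
        = (globalMaxwellian v * (((Real.sqrt s) ^ 3)⁻¹ * exp (‖v‖ ^ 2 / 2 - ‖v - p‖ ^ 2 / (2 * s)))) *
          g v := by ring
      _ = ((Real.sqrt s) ^ 3)⁻¹ * globalMaxwellian ((Real.sqrt s)⁻¹ • (v - p)) * g v := by rw [this]
      _ = ((Real.sqrt s) ^ 3)⁻¹ * (globalMaxwellian ((Real.sqrt s)⁻¹ • (v - p)) * g v) := by ring
  -- left-hand side: `∫ M(u) g(p + √s u) du = ∫ F(p + √s u) du = σ ∫ F`
  have hL : (fun u => globalMaxwellian u * g (p + Real.sqrt s • u)) = fun u => F (p + Real.sqrt s • u) := by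
    funext u
    rw [hF]
    simp only [add_sub_cancel_left, inv_smul_smul₀ hsqrt.ne']
  have hscale : ∫ u, F (p + Real.sqrt s • u) = |((Real.sqrt s) ^ Module.finrank ℝ V3)⁻¹| * ∫ w, F (p + w) :=
    Measure.integral_comp_smul volume (fun w => F (p + w)) (Real.sqrt s)
  have hfin : Module.finrank ℝ V3 = 3 := finrank_euclideanSpace_fin
  rw [hR, hL, integral_const_mul, hscale, hfin, abs_of_pos hσ, integral_add_left_eq_self F p]

/-- The likelihood ratio in logarithmic form: `s^{-3/2}e^{E} = exp(−(3/2)log s + E)`. [folklore] -/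
theorem lr_eq_exp {s : ℝ} (hs : 0 < s) (E : ℝ) :
    ((Real.sqrt s) ^ 3)⁻¹ * exp E = exp (-(3 / 2) * log s + E) := by
  rw [exp_add]
  congr 1
  have h1 : (Real.sqrt s) ^ 3 = exp (3 / 2 * log s) := by
    rw [← Real.exp_log (pow_pos (Real.sqrt_pos.2 hs) 3), Real.log_pow, Real.log_sqrt hs.le]
    congr 1
    push_cast
    ring
  rw [h1, ← Real.exp_neg]
  congr 1
  ring

/-! ## §3 The registered stub -/

/-- **Second-order vanishing of Maxwellian means (registered stub `stub_maxwellianSecondOrder` of the line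
`almost-invariant-duality`, crux stmt-AtomisticToContinuum-14135).** There is a universal `C₂ ≥ 1` such that for
every continuous `g : ℝ³ → ℝ` with `|g| ≤ κ` orthogonal in `L²(γ)` to `1, v, |v|²`, every drift `p` and every
temperature `s ≥ 0`: `|∫ g(p + √s u) dγ(u)| ≤ κ · C₂ · min 1 (‖p‖² + (s − 1)²)`. -/
theorem stub_maxwellianSecondOrder :
    ∃ C₂ : ℝ, 1 ≤ C₂ ∧ ∀ (κ : ℝ) (g : V3 → ℝ), Continuous g → (∀ v, |g v| ≤ κ) →
      (∀ (c₀ c₂ : ℝ) (b : V3), ∫ v, g v * (c₀ + inner ℝ b v + c₂ * ‖v‖ ^ 2) ∂(stdGaussian V3) = 0) →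
      ∀ (p : V3) (s : ℝ), 0 ≤ s →
        |∫ u, g (p + Real.sqrt s • u) ∂(stdGaussian V3)| ≤ κ * C₂ * min 1 (‖p‖ ^ 2 + (s - 1) ^ 2) := by
  -- Fernique: `∫ exp(C‖v‖²) dγ < ∞` for some `C > 0`; work at `c = min C 1`
  obtain ⟨C, hC, hIntC⟩ := IsGaussian.exists_integrable_exp_sq (stdGaussian V3)
  obtain ⟨c, hc, hc1, hcC⟩ : ∃ c : ℝ, 0 < c ∧ c ≤ 1 ∧ c ≤ C :=
    ⟨min C 1, lt_min hC one_pos, min_le_right _ _, min_le_left _ _⟩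
  have hIc : Integrable (fun v : V3 => exp (c * ‖v‖ ^ 2)) (stdGaussian V3) := by
    refine hIntC.mono (by fun_prop) (ae_of_all _ fun v => ?_)
    rw [Real.norm_eq_abs, Real.norm_eq_abs, abs_of_pos (exp_pos _), abs_of_pos (exp_pos _)]
    exact exp_le_exp.2 (by gcongr)
  obtain ⟨I, hI_def⟩ : ∃ I : ℝ, I = ∫ v, exp (c * ‖v‖ ^ 2) ∂(stdGaussian V3) := ⟨_, rfl⟩
  have hI : 0 ≤ I := by rw [hI_def]; exact integral_nonneg fun v => (exp_pos _).le
  obtain ⟨K, hK_def⟩ : ∃ K : ℝ, K = 6 * exp (3 / 2) * (18 + 16 / c ^ 2) + 4 + 1 / c := ⟨_, rfl⟩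
  have hK : 0 < K := by rw [hK_def]; positivity
  refine ⟨max (16 / c ^ 2) (max 1 (K * I)), le_max_of_le_right (le_max_left _ _), ?_⟩
  intro κ g hg hgκ horth p s hs
  have hκ : 0 ≤ κ := (abs_nonneg _).trans (hgκ 0)
  -- the trivial bound `|m| ≤ κ`
  have htriv : |∫ u, g (p + Real.sqrt s • u) ∂(stdGaussian V3)| ≤ κ := by
    have h := norm_integral_le_of_norm_le_const (μ := stdGaussian V3)
      (f := fun u => g (p + Real.sqrt s • u)) (C := κ) (ae_of_all _ fun u => by
        rw [Real.norm_eq_abs]; exact hgκ _)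
    simpa [Real.norm_eq_abs] using h
  by_cases hfar : (c / 4) ^ 2 ≤ ‖p‖ ^ 2 + (s - 1) ^ 2
  · -- far from `(0, 1)`: the trivial bound suffices
    have hc16 : (c / 4) ^ 2 ≤ 1 := by nlinarith
    have hmin : (c / 4) ^ 2 ≤ min 1 (‖p‖ ^ 2 + (s - 1) ^ 2) := le_min hc16 hfar
    calc |∫ u, g (p + Real.sqrt s • u) ∂(stdGaussian V3)| ≤ κ := htriv
      _ = κ * (16 / c ^ 2) * (c / 4) ^ 2 := by field_simp; ring
      _ ≤ κ * max (16 / c ^ 2) (max 1 (K * I)) * min 1 (‖p‖ ^ 2 + (s - 1) ^ 2) := by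
          gcongr
          exact le_max_left _ _
  -- near `(0, 1)`: change of variables, orthogonality, pointwise remainder estimate
  rw [not_le] at hfar
  set r2 : ℝ := ‖p‖ ^ 2 + (s - 1) ^ 2 with hr2
  have hr2nn : 0 ≤ r2 := by positivity
  have hpc : ‖p‖ ≤ c / 4 := by
    have h1 : ‖p‖ ^ 2 < (c / 4) ^ 2 := by nlinarith [sq_nonneg (s - 1)]
    have := abs_lt_of_sq_lt_sq h1 (by positivity)
    rw [abs_of_nonneg (norm_nonneg p)] at this
    exact this.le
  have htc : |s - 1| ≤ c / 4 := by
    have h1 : (s - 1) ^ 2 < (c / 4) ^ 2 := by nlinarith [sq_nonneg ‖p‖]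
    exact (abs_lt_of_sq_lt_sq h1 (by positivity)).le
  have hs_pos : 0 < s := by
    have := (abs_le.1 htc).1
    linarith
  have hmin : min 1 r2 = r2 := min_eq_right (by nlinarith)
  rw [hmin]
  -- the likelihood ratio `Lf` and its affine-quadratic Taylor part `ℓf`
  set Lf : V3 → ℝ := fun v => ((Real.sqrt s) ^ 3)⁻¹ * exp (‖v‖ ^ 2 / 2 - ‖v - p‖ ^ 2 / (2 * s)) with hLf
  set ℓf : V3 → ℝ := fun v => (1 - 3 * (s - 1) / 2) + inner ℝ p v + (s - 1) / 2 * ‖v‖ ^ 2 with hℓf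
  have hcv : ∫ u, g (p + Real.sqrt s • u) ∂(stdGaussian V3) = ∫ v, g v * Lf v ∂(stdGaussian V3) :=
    integral_comp_affine_stdGaussian hs_pos p g
  have horth' : ∫ v, g v * ℓf v ∂(stdGaussian V3) = 0 := horth _ _ p
  -- pointwise facts at `v`: scalar variables `x = ‖v‖²`, `q = ⟨p, v⟩`, `a = ‖p‖`, `t = s − 1`
  have hq2 : ∀ v : V3, 2 * |inner ℝ p v| ≤ ‖p‖ * (1 + ‖v‖ ^ 2) := fun v => by
    have h1 : |inner ℝ p v| ≤ ‖p‖ * ‖v‖ := abs_real_inner_le_norm p v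
    have h2 : 2 * ‖v‖ ≤ 1 + ‖v‖ ^ 2 := by nlinarith [sq_nonneg (‖v‖ - 1)]
    nlinarith [norm_nonneg p, norm_nonneg v]
  have hLf_eq : ∀ v : V3, Lf v = exp (-(3 / 2) * log (1 + (s - 1)) +
      (‖v‖ ^ 2 / 2 - (‖v‖ ^ 2 - 2 * inner ℝ p v + ‖p‖ ^ 2) / (2 * (1 + (s - 1))))) := fun v => by
    rw [hLf]
    simp only
    rw [lr_eq_exp hs_pos, norm_sub_sq_real, real_inner_comm p v]
    congr 1
    ring_nf
  have hℓf_eq : ∀ v : V3, ℓf v = 1 + (inner ℝ p v + (s - 1) * (‖v‖ ^ 2 - 3) / 2) := fun v => by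
    rw [hℓf]
    ring
  have hpt : ∀ v : V3, |Lf v - ℓf v| ≤ r2 * (K * exp (c * ‖v‖ ^ 2)) := fun v => by
    have hk := scalar_key' (x := ‖v‖ ^ 2) (q := inner ℝ p v) (a := ‖p‖) (t := s - 1) hc hc1 (by positivity)
      (norm_nonneg p) (hq2 v) hpc htc
    have e : Lf v - ℓf v = Lf v - 1 - (inner ℝ p v + (s - 1) * (‖v‖ ^ 2 - 3) / 2) := by
      rw [hℓf_eq v]
      ring
    rw [e, hLf_eq v, hr2, hK_def]
    exact hk
  have hLf_le : ∀ v : V3, Lf v ≤ exp (3 / 2) * exp (c * ‖v‖ ^ 2) := fun v => by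
    rw [hLf_eq v]
    exact exp_hfun_le (x := ‖v‖ ^ 2) (q := inner ℝ p v) (a := ‖p‖) (t := s - 1) hc1 (by positivity)
      (norm_nonneg p) (hq2 v) hpc htc
  have hLf_nn : ∀ v : V3, 0 ≤ Lf v := fun v => by rw [hLf_eq v]; exact (exp_pos _).le
  have hℓf_le : ∀ v : V3, |ℓf v| ≤ (2 + 1 / c) * exp (c * ‖v‖ ^ 2) := fun v => by
    have h1 := abs_ell0_le (x := ‖v‖ ^ 2) (q := inner ℝ p v) (a := ‖p‖) (t := s - 1) (by positivity)
      (hpc.trans (by linarith : c / 4 ≤ 1 / 4)) (hq2 v) (htc.trans (by linarith : c / 4 ≤ 1 / 4))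
    have q2 : (1 : ℝ) ≤ exp (c * ‖v‖ ^ 2) := one_le_exp_mul hc.le (by positivity)
    have q3 : ‖v‖ ^ 2 ≤ c⁻¹ * exp (c * ‖v‖ ^ 2) := le_exp_mul hc
    rw [hℓf_eq v]
    calc |1 + (inner ℝ p v + (s - 1) * (‖v‖ ^ 2 - 3) / 2)|
        ≤ |(1 : ℝ)| + |inner ℝ p v + (s - 1) * (‖v‖ ^ 2 - 3) / 2| := abs_add_le _ _
      _ ≤ 1 + (1 + ‖v‖ ^ 2) := by rw [abs_one]; gcongr
      _ ≤ 2 * exp (c * ‖v‖ ^ 2) + c⁻¹ * exp (c * ‖v‖ ^ 2) := by linarith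
      _ = (2 + 1 / c) * exp (c * ‖v‖ ^ 2) := by rw [one_div]; ring
  -- measurability
  have hLf_cont : Continuous Lf := by
    rw [hLf]
    fun_prop
  have hℓf_cont : Continuous ℓf := by
    rw [hℓf]
    fun_prop
  -- integrability of `g·Lf` and `g·ℓf` by domination
  have hgL : Integrable (fun v => g v * Lf v) (stdGaussian V3) := by
    refine (hIc.const_mul (κ * exp (3 / 2))).mono' (hg.mul hLf_cont).aestronglyMeasurable
      (ae_of_all _ fun v => ?_)
    rw [Real.norm_eq_abs, abs_mul, abs_of_nonneg (hLf_nn v)]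
    calc |g v| * Lf v ≤ κ * (exp (3 / 2) * exp (c * ‖v‖ ^ 2)) :=
          mul_le_mul (hgκ v) (hLf_le v) (hLf_nn v) hκ
      _ = κ * exp (3 / 2) * exp (c * ‖v‖ ^ 2) := by ring
  have hgℓ : Integrable (fun v => g v * ℓf v) (stdGaussian V3) := by
    refine (hIc.const_mul (κ * (2 + 1 / c))).mono' (hg.mul hℓf_cont).aestronglyMeasurable
      (ae_of_all _ fun v => ?_)
    rw [Real.norm_eq_abs, abs_mul]
    calc |g v| * |ℓf v| ≤ κ * ((2 + 1 / c) * exp (c * ‖v‖ ^ 2)) :=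
          mul_le_mul (hgκ v) (hℓf_le v) (abs_nonneg _) hκ
      _ = κ * (2 + 1 / c) * exp (c * ‖v‖ ^ 2) := by ring
  -- the estimate
  have hdiff : ∫ v, g v * Lf v ∂(stdGaussian V3) = ∫ v, (g v * Lf v - g v * ℓf v) ∂(stdGaussian V3) := by
    rw [integral_sub hgL hgℓ, horth', sub_zero]
  have hbound : |∫ v, (g v * Lf v - g v * ℓf v) ∂(stdGaussian V3)| ≤ κ * r2 * K * I := by
    have h := norm_integral_le_of_norm_le (μ := stdGaussian V3) (f := fun v => g v * Lf v - g v * ℓf v)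
      (hIc.const_mul (κ * r2 * K)) (ae_of_all _ fun v => by
        rw [Real.norm_eq_abs, ← mul_sub, abs_mul]
        calc |g v| * |Lf v - ℓf v| ≤ κ * (r2 * (K * exp (c * ‖v‖ ^ 2))) :=
              mul_le_mul (hgκ v) (hpt v) (abs_nonneg _) hκ
          _ = κ * r2 * K * exp (c * ‖v‖ ^ 2) := by ring)
    rw [integral_const_mul, ← hI_def] at h
    simpa [Real.norm_eq_abs] using h
  calc |∫ u, g (p + Real.sqrt s • u) ∂(stdGaussian V3)|
      = |∫ v, (g v * Lf v - g v * ℓf v) ∂(stdGaussian V3)| := by rw [hcv, hdiff]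
    _ ≤ κ * r2 * K * I := hbound
    _ = κ * (K * I) * r2 := by ring
    _ ≤ κ * max (16 / c ^ 2) (max 1 (K * I)) * r2 := by
        gcongr
        exact le_max_of_le_right (le_max_right _ _)

end Summit.AtomisticToContinuum.HydrodynamicLimit.Theorems.MaxwellianSecondOrder
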